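import Summits.Schanuel.Schanuel.Theorems.SoloInformedAE3StructuredRoots
import Summits.Schanuel.Schanuel.Theorems.SoloInformedStructuredNonConjugate
import Summits.Schanuel.Schanuel.Theorems.SoloInformedDilatedFactor

/-!
# Theorem AE₃-1, middle: from Roy's additive data to an input for Gel'fond's criterion

Soloist file (informed mode, seat `solo-Schanuel-informed`, s182).  Steps 4–5 of the proof
of the seat's THEOREM AE₃-1 (`paper/AE-note.md` §14, `η = 0` form) on the node
`RoyAdditiveDirichletExponent` ([cite: Roy2010, Thm 1.1]) — the verbatim analogue of
`SoloInformedAE1GelfondInput` on top of the 3-term-progression structured-roots theorem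
`soloS3_structured_roots`: a polynomial `P ∈ RoyAdditiveSmall ξ β σ τ ν n` has `≥ (49/100) K`
roots `γ + s μ` (`s ∈ S' ⊆ [1, K]`, `μ ≠ 0`) within `ε = exp(-W)`, `W = n^ν K / (80000 n)`, of
the points `s ξ`; by `soloNC_exists_cheap_factor_on_progression` (Lemma H + pigeonhole; it
needs only `#S' > K/5`) one of them lies on an irreducible factor `q ∣ P` with
`deg q ≤ 20 n / K` and `log M(q) ≤ 40 n^β / K`; and by `soloDF_package` the dilated polynomial
`Q = q(sT) ∈ ℤ[X]` is non-zero with `deg Q ≤ 20 n / K`, Gel'fond type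
`≤ (20 n / K)(2 + log K) + 40 n^β / K` and `‖Q(ξ)‖ ≤ exp(-W/2)` (given one more explicit
inequality, `h₆`).  For `K = ⌊n^σ⌋` these are `O(n^{1-σ} log n + n^{β-σ})` against
`W ≍ n^{ν+σ-1}` — the input of Gel'fond's criterion at the single point `ξ` (the last file of
the series runs the asymptotics).

What this is NOT.  Not yet THEOREM AE₃-1, and nothing here bears on
`Literature.Periods.SchanuelConjecture` (the seat's verdict, no path, is unchanged); the node
[cite: Roy2010, Thm 1.1] is not claimed.  Tree files and Mathlib only; no definitions, no
literature hypothesis; axioms the standard three.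
-/

namespace Summit.Schanuel.Schanuel.Theorems

open Polynomial Finset

/-- **Gel'fond input from Roy's additive data, 3-AP version (AE-note §14, `η = 0`).**  Under
the hypotheses of `soloS3_structured_roots` plus `ξ` transcendental and
`h₆ : (20 n / K) log (K‖ξ‖ + 1) + 40 n^β / K ≤ W / 2` (`W = n^ν K / (80000 n)`), there is a
non-zero `Q ∈ ℤ[X]` with `deg Q ≤ 20 n / K`,
`t(Q) ≤ (20 n / K)(2 + log K) + 40 n^β / K` and `‖Q(ξ)‖ ≤ exp(-W/2)`. -/
theorem soloG3_gelfond_input {ξ : ℂ} (hξ : Transcendental ℚ ξ) {β σ τ ν : ℝ} (hβ : 1 ≤ β)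
    {n K : ℕ} (hn : 1 ≤ n) (hK : 2000 ≤ K) (hKσ : (K : ℝ) ≤ (n : ℝ) ^ σ) {c₁ : ℝ}
    (hc : Real.exp (-c₁) ≤ min 1 (‖ξ‖ / 2)) (h₁ : 2 * c₁ * n ≤ (n : ℝ) ^ ν)
    (h₄ : Real.log 4 ≤ (n : ℝ) ^ ν * K / (160000 * n))
    (h₅ : 288000000000 * ((n : ℝ) ^ 3 * (n : ℝ) ^ β) ≤ (K : ℝ) ^ 3 * (n : ℝ) ^ ν)
    (h₆ : 20 * n / K * Real.log (K * ‖ξ‖ + 1) + 40 * (n : ℝ) ^ β / K ≤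
      (n : ℝ) ^ ν * K / (160000 * n))
    {P : ℤ[X]} (hP : P ∈ RoyAdditiveSmall ξ β σ τ ν n) :
    ∃ Q : ℤ[X], Q ≠ 0 ∧ (Q.natDegree : ℝ) ≤ 20 * n / K ∧
      Q.gelfondType ≤ 20 * n / K * (2 + Real.log K) + 40 * (n : ℝ) ^ β / K ∧
      ‖aeval ξ Q‖ ≤ Real.exp (-((n : ℝ) ^ ν * K / (160000 * n))) := by
  obtain ⟨S', hS'sub, hS'card, γ, μ, hμ, hroots⟩ :=
    soloS3_structured_roots hβ hn hK hKσ hc h₁ h₄ h₅ hP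
  obtain ⟨hP0, hdeg, hht, -⟩ := hP
  have hn0 : (0 : ℝ) < n := by exact_mod_cast hn
  have hK0 : (0 : ℝ) < K := by exact_mod_cast (show 0 < K by omega)
  have hK1 : (1 : ℝ) ≤ K := by exact_mod_cast (show 1 ≤ K by omega)
  set W : ℝ := (n : ℝ) ^ ν * K / (80000 * n) with hW
  have hW2 : (n : ℝ) ^ ν * K / (160000 * n) = W / 2 := by rw [hW]; ring
  -- Step 4: a cheap irreducible factor through one of the structured roots
  have hd₀ : (0 : ℝ) < 20 * n / K := by positivity
  have hβ0 : (0 : ℝ) < (n : ℝ) ^ β := Real.rpow_pos_of_pos hn0 β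
  have hh₀ : (0 : ℝ) < 40 * (n : ℝ) ^ β / K := by positivity
  obtain ⟨hlogM0, hlogM⟩ := soloSR_log_mahlerMeasure_le hP0 hn hdeg hβ hht
  have hbudget : 2 * (P.natDegree / (20 * n / K) +
      Real.log (P.map (Int.castRingHom ℂ)).mahlerMeasure / (40 * (n : ℝ) ^ β / K)) < #S' := by
    have hd : (P.natDegree : ℝ) / (20 * n / K) ≤ K / 20 := by
      rw [div_le_iff₀ hd₀]
      have : (P.natDegree : ℝ) ≤ n := by exact_mod_cast hdeg
      calc (P.natDegree : ℝ) ≤ n := this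
        _ = K / 20 * (20 * n / K) := by field_simp
    have hh : Real.log (P.map (Int.castRingHom ℂ)).mahlerMeasure / (40 * (n : ℝ) ^ β / K) ≤
        K / 20 := by
      rw [div_le_iff₀ hh₀]
      calc Real.log (P.map (Int.castRingHom ℂ)).mahlerMeasure ≤ 2 * (n : ℝ) ^ β := hlogM
        _ = K / 20 * (40 * (n : ℝ) ^ β / K) := by field_simp; ring
    linarith
  obtain ⟨s, hs, q, hqirr, hqdeg, -, hqval, hqd, hqh⟩ :=
    soloNC_exists_cheap_factor_on_progression P hP0 γ μ hμ S' (fun s hs => (hroots s hs).1)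
      hd₀ hh₀ hbudget
  have hq0 : q ≠ 0 := hqirr.ne_zero
  have hs1 : 1 ≤ s := (Finset.mem_Icc.mp (hS'sub hs)).1
  have hsK : s ≤ K := (Finset.mem_Icc.mp (hS'sub hs)).2
  -- Step 5: the dilated factor `q(sT)`
  obtain ⟨Q, hQ0, hQdeg, hQtype, -, hQval⟩ :=
    soloDF_package hξ q hq0 hqval hs1 hsK (Real.exp_pos _).le (hroots s hs).2
  refine ⟨Q, hQ0, ?_, ?_, ?_⟩
  · rw [hQdeg]; exact hqd
  · have hlogK : 0 ≤ 2 + Real.log K := by linarith [Real.log_nonneg hK1]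
    calc Q.gelfondType ≤ q.natDegree * (2 + Real.log K) +
          Real.log (q.map (Int.castRingHom ℂ)).mahlerMeasure := hQtype
      _ ≤ 20 * n / K * (2 + Real.log K) + 40 * (n : ℝ) ^ β / K :=
          add_le_add (mul_le_mul_of_nonneg_right hqd hlogK) hqh
  · have hM0 : 0 < (q.map (Int.castRingHom ℂ)).mahlerMeasure :=
      zero_lt_one.trans_le (Polynomial.one_le_mahlerMeasure_of_ne_zero hq0)
    have hB0 : 0 < (K : ℝ) * ‖ξ‖ + 1 := by positivity
    have hL0 : 0 ≤ Real.log ((K : ℝ) * ‖ξ‖ + 1) :=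
      Real.log_nonneg (by nlinarith [norm_nonneg ξ])
    have hrew : Real.exp (-W) * ((K : ℝ) * ‖ξ‖ + 1) ^ q.natDegree *
        (q.map (Int.castRingHom ℂ)).mahlerMeasure =
        Real.exp (-W + q.natDegree * Real.log ((K : ℝ) * ‖ξ‖ + 1) +
          Real.log (q.map (Int.castRingHom ℂ)).mahlerMeasure) := by
      rw [Real.exp_add, Real.exp_add, Real.exp_nat_mul, Real.exp_log hB0, Real.exp_log hM0]
    refine hQval.trans ?_
    rw [hrew, hW2, Real.exp_le_exp]
    have h7 : (q.natDegree : ℝ) * Real.log ((K : ℝ) * ‖ξ‖ + 1) ≤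
        20 * n / K * Real.log ((K : ℝ) * ‖ξ‖ + 1) := mul_le_mul_of_nonneg_right hqd hL0
    linarith

end Summit.Schanuel.Schanuel.Theorems
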